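import Summits.MatrixMultiplication.OmegaCensus.STPPKernelListerKillsZ47
import Literature.Combinatorics.Additive.TightTriangleRemovalProofs

/-!
# ω-census (abelian STPP census): **every abelian group of order `47` admits no beating STPP family — KERNEL, UNCONDITIONAL, H-generic form**

HONEST FRAMING (pub-omega census; verbatim): lottery ticket; floor = certified bounds/negative ranges.
Census STRUCTURE (seat pub-omega-stpp-2 gen 30, 2026-08-29), family (b2).  Nothing here is progress on `ω`.  The ℤ₄₇ capstone
`CubeNB.volume_le_card_zmod47` (`STPPKernelListerKillsZ47`) transported to an arbitrary finite abelian group `H` of order `47` along the additive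
isomorphism `H ≃+ ZMod 47` of two groups of the same prime order (`addEquivOfPrimeCardEq`) and the transport of `IsSTPP` along injective additive
homs (`IsSTPP.image`), so that order `47` joins the H-generic order-capstone series `KLister.volume_le_of_card_eq_<n>` (orders `≤ 32`, `34`, `37–41`,
`43` dead-list-free; `47` via the three Vosper kills).
-/

open Finset

namespace Summit.MatrixMultiplication.OmegaCensus.KLister

open Literature.Computability.AlgebraicComplexity

/-- **Every abelian group of order `47` admits no beating STPP family — KERNEL:** for every finite abelian group `H` with `|H| = 47`, every `m`
and every STPP family `(Aᵢ, Bᵢ, Cᵢ)_{i<m}` of `H` (CKSU Def. 5.1), `Σᵢ |Aᵢ||Bᵢ||Cᵢ| ≤ 47`. [cite: CohnKleinbergSzegedyUmans2005, Def. 5.1, Thm. 5.5] -/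
theorem volume_le_of_card_eq_47 {H : Type*} [AddCommGroup H] [Fintype H] [DecidableEq H] (hH : Fintype.card H = 47)
    {m : ℕ} (A B C : Fin m → Finset H) (hS : IsSTPP A B C) : ∑ i, #(A i) * #(B i) * #(C i) ≤ 47 := by
  haveI : Fact (Nat.Prime 47) := ⟨by norm_num⟩
  have h1 : Nat.card H = 47 := by rw [Nat.card_eq_fintype_card, hH]
  have h2 : Nat.card (ZMod 47) = 47 := Nat.card_zmod 47
  let e : H ≃+ ZMod 47 := addEquivOfPrimeCardEq h1 h2
  have hS' : IsSTPP (fun i => (A i).image e) (fun i => (B i).image e) (fun i => (C i).image e) := hS.image e e.injective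
  have h := CubeNB.volume_le_card_zmod47 _ _ _ hS'
  simp only [card_image_of_injective _ e.injective] at h
  exact h

end Summit.MatrixMultiplication.OmegaCensus.KLister
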